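import Summits.BirchSwinnertonDyer.BirchSwinnertonDyer.Theorems.ThetaPartnerAtTwoMazurTateCongruenceAtTwoRDepletedPeriodLattice
import Summits.BirchSwinnertonDyer.BirchSwinnertonDyer.Theorems.ResidualThetaTransportAtTwoThetaLayerLambdaCongruenceAtTwoDepletedHeckeAlgebra
import Summits.BirchSwinnertonDyer.BirchSwinnertonDyer.Theorems.ResidualThetaTransportAtTwoThetaLayerLambdaCongruenceAtTwoCurveEulerHecke
import Literature.NumberTheory.EllipticCurves.GreenbergVatsal2000.EulerFactorDepletion
import Literature.NumberTheory.EllipticCurves.PAdicLFunctionDistributionHoldsProofs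
import Literature.NumberTheory.EllipticCurves.ModularFormsGamma0Genus
import Literature.NumberTheory.EllipticCurves.QuadraticTwistRamifiedLocalPolynomialProofs
import HarnessLib

/-!
# Crux C1 `MainConjectureTransportAlignedAtTwo` (stmt-BirchSwinnertonDyer-22296), line `birth`, plan «ord-plusline» step (P):
# THE MODULAR SYMBOLS OF THE `S`-DEPLETED OLDFORM — `{∞, r}_g = ∑_m w_m {∞, m r}_f` with the Euler-factor depletion weights
# (lead att-p1 g9; `--supports 22296`)

THEOREMS ONLY (no `def`, no `sorry`, no named fact). BSD is not proved by this; C1 is not closed by this.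

For `f ∈ S₂(Γ₀(N))` with integer coefficients and `T_p f = a_p(f) f` for every prime `p`, a finite set `S` of primes and the `S`-DEPLETED form
`g ∈ S₂(Γ₀(L))`, `L = N·∏_{ℓ∈S} ℓ²` (`a_n(g) = 𝟙_{(n,S)=1} a_n(f)`; the tree's sieve `K_ℓ = 1 − ι_ℓ U_ℓ`, `exists_cuspForm_coeff_eq_depleted`), this
file proves the EXACT period formula at every rational point `r`:

  `{∞, r}_g = (∏_{ℓ∈S} D_ℓ) · {∞, ·}_f (r)`,  `D_ℓ = [1] − (a_ℓ(f)/ℓ)[ℓ] + 𝟙_{ℓ∤N} ℓ⁻¹ [ℓ²]`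

(`[m]` = dilation `r ↦ m r`, acting through cell bsd-wall's monoid-algebra action `D.coeff.sum (fun m a ↦ a * ψ (m x))`,
`…ThetaLayerLambdaCongruenceAtTwoDepletedHeckeAlgebra`; `D_ℓ = P_ℓ(E, ℓ⁻¹[ℓ])` is the Greenberg–Vatsal / Emerton–Pollack–Weston depletion
operator, `P_ℓ = 1 − a_ℓX + 𝟙_{ℓ∤N} ℓ X²`). Induction over the sieve as in bsd-wall's `DepletedLattice.mul_cuspSymbol_depleted_mem_of_eq`
(`g = K_ℓ g₀ = g₀ − ι_ℓ(T_ℓ g₀ − 𝟙_{ℓ∤L₀} ℓ ι_ℓ g₀)`, `{∞, r}_{ι_d h} = d⁻¹{∞, d r}_h` = `modularSymbol_iota`), now as an IDENTITY instead of a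
lattice membership. Also the flexible-level form (`N·∏ℓ² ∣ L`, same formula: `toLevel0` does not change the function).
This is the bridge between the depleted form `g` (on which the Hecke algebra of level `L` and Buzzard's multiplicity one act, plan steps K/A) and the
depleted plus-symbol TABLES of `f` (`GreenbergVatsal2000.eulerDepleteTableList`, on which the `2`-adic `λ`-bookkeeping of the line runs, plan step R).

References: Atkin–Lehner, Math. Ann. 185 (1970) §3 [AtkinLehner1970]; Cremona, *Algorithms* (1997) §2.4 [CremonaAlgorithms1997];
Greenberg–Vatsal, Invent. Math. 142 (2000) §1 (8) [GreenbergVatsal2000]; Emerton–Pollack–Weston, Invent. Math. 163 (2006) §3 (3.4)–(3.5)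
[EmertonPollackWeston2006].
-/

noncomputable section

-- justification: the `Summit.BirchSwinnertonDyer.BirchSwinnertonDyer.…` path repeats a component (route-file convention)
set_option linter.dupNamespace false
set_option autoImplicit false

open scoped MatrixGroups ModularForm Classical

open CongruenceSubgroup Complex
open Literature.NumberTheory.EllipticCurves Literature.NumberTheory.EllipticCurves.ModularForms
open Summit.BirchSwinnertonDyer.BirchSwinnertonDyer.Theorems.ThetaLayerLambdaCongruenceAtTwo
open Summit.BirchSwinnertonDyer.BirchSwinnertonDyer.Theorems.MazurTateCongruenceAtTwoR.DepletedLattice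

namespace Summit.BirchSwinnertonDyer.BirchSwinnertonDyer.Theorems.AlignedTransportAtTwoDepletedPeriodFormula

/-! ## §1 Small tools: modular symbols of differences, of `toLevel0`, and the action of one depletion factor -/

/-- `{∞, r}_{h₁ − h₂} = {∞, r}_{h₁} − {∞, r}_{h₂}`. [folklore] -/
theorem modularSymbol_sub {N : ℕ} [NeZero N] (h₁ h₂ : CuspForm (Gamma0 N) 2) (r : ℚ) :
    modularSymbol (h₁ - h₂) r = modularSymbol h₁ r - modularSymbol h₂ r := by
  rw [sub_eq_add_neg, ← neg_one_smul ℂ h₂, modularSymbol_add, modularSymbol_const_smul]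
  ring

/-- `{∞, r}` does not see the change of level `toLevel0`. [folklore] -/
theorem modularSymbol_toLevel0 {M N' : ℕ} (h : M ∣ N') (g : CuspForm (Gamma0 M) 2) (r : ℚ) :
    modularSymbol (toLevel0 h 2 g) r = modularSymbol g r := by
  simp only [modularSymbol, coe_toLevel0]

/-- **The action of one depletion factor** `D_ℓ = [1] + c₁[ℓ] + c₂[ℓ²]` on a function: `(D_ℓ·ψ)(x) = ψ(x) + c₁ψ(ℓx) + c₂ψ(ℓ²x)`. [folklore] -/
theorem act_depletionFactor (ψ : ℚ → ℂ) (ℓ : ℕ) (c₁ c₂ : ℂ) (x : ℚ) :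
    ((MonoidAlgebra.single 1 (1 : ℂ) + MonoidAlgebra.single ℓ c₁ + MonoidAlgebra.single (ℓ ^ 2) c₂ : MonoidAlgebra ℂ ℕ).coeff.sum
        (fun m a ↦ a * ψ ((m : ℚ) * x))) =
      ψ x + c₁ * ψ ((ℓ : ℚ) * x) + c₂ * ψ (((ℓ ^ 2 : ℕ) : ℚ) * x) := by
  rw [act_add, act_add, act_single, act_single, act_single, Nat.cast_one, one_mul, one_mul]

/-! ## §2 The period formula at the exact depleted level `L = N·∏_{ℓ∈S} ℓ²` -/

/-- **`{∞, r}_g = (∏_{ℓ∈S} D_ℓ)·{∞, ·}_f (r)` for the `S`-depleted form `g`**, `D_ℓ = [1] − (a_ℓ(f)/ℓ)[ℓ] + 𝟙_{ℓ∤N} ℓ⁻¹[ℓ²]`: for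
`f ∈ S₂(Γ₀(N))` with `T_p f = a_p(f) f` for all primes `p`, a finite set of primes `S`, `L = N·∏_{ℓ∈S} ℓ²`, and
`g ∈ S₂(Γ₀(L))` with `a_n(g) = 𝟙_{(n,S)=1} a_n(f)`, every modular symbol of `g` is the depleted combination of modular symbols of `f`.
Induction over the sieve (`g = K_ℓ g₀`, `exists_cuspForm_coeff_eq_depleted`, `qExpansion_coeff_sieveOp`, `eq_of_forall_cuspCoeff_eq_gamma0`),
with `{∞, r}_{ι_ℓ h} = ℓ⁻¹{∞, ℓ r}_h` (`modularSymbol_iota`) and `T_ℓ g₀ = a_ℓ(f) g₀` (`depleted_heckeT_eq_smul`).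
[cite: AtkinLehner1970, §3] [cite: CremonaAlgorithms1997, §2.4] [cite: EmertonPollackWeston2006, §3 (3.4)–(3.5)] -/
theorem modularSymbol_depleted_eq_act {N : ℕ} [NeZero N] (f : CuspForm (Gamma0 N) 2)
    (hT : ∀ (p : ℕ) (hp : p.Prime), (haveI : NeZero p := ⟨hp.ne_zero⟩; heckeT (Gamma0 N) 2 p f) = cuspCoeff f p • f)
    (S : Finset ℕ) (hS : ∀ ℓ ∈ S, ℓ.Prime) (L : ℕ) [NeZero L] (hL : L = N * ∏ ℓ ∈ S, ℓ ^ 2)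
    (g : CuspForm (Gamma0 L) 2) (hg : ∀ n : ℕ, cuspCoeff g n = if ∃ ℓ ∈ S, ℓ ∣ n then 0 else cuspCoeff f n)
    (r : ℚ) :
    modularSymbol g r =
      ((∏ ℓ ∈ S, (MonoidAlgebra.single 1 (1 : ℂ) + MonoidAlgebra.single ℓ (-(cuspCoeff f ℓ) * (ℓ : ℂ)⁻¹) +
          MonoidAlgebra.single (ℓ ^ 2) (if ℓ ∣ N then 0 else (ℓ : ℂ)⁻¹) : MonoidAlgebra ℂ ℕ)).coeff.sum
        fun m a ↦ a * modularSymbol f ((m : ℚ) * r)) := by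
  classical
  induction S using Finset.induction_on generalizing L g r with
  | empty =>
    have hNL : N ∣ L := by rw [hL]; exact dvd_mul_right N _
    have hgf : g = toLevel0 hNL 2 f := by
      refine eq_of_forall_cuspCoeff_eq_gamma0 fun n ↦ ?_
      rw [hg n, if_neg (by simp)]
      rfl
    rw [Finset.prod_empty, MonoidAlgebra.one_def, act_single, Nat.cast_one, one_mul, one_mul, hgf, modularSymbol_toLevel0]
  | insert ℓ S hℓS ih =>
    have hSp : ∀ ℓ' ∈ S, ℓ'.Prime := fun ℓ' h ↦ hS ℓ' (Finset.mem_insert_of_mem h)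
    have hℓ : ℓ.Prime := hS ℓ (Finset.mem_insert_self ℓ S)
    set L₀ : ℕ := N * ∏ ℓ' ∈ S, ℓ' ^ 2 with hL₀
    haveI : NeZero L₀ := ⟨mul_ne_zero (NeZero.ne N) (prod_sq_ne_zero_of_prime S hSp)⟩
    haveI : NeZero ℓ := ⟨hℓ.ne_zero⟩
    obtain ⟨g₀, hg₀⟩ := exists_cuspForm_coeff_eq_depleted f S hSp L₀ rfl
    have hL' : L = L₀ * ℓ * ℓ := by
      rw [hL, Finset.prod_insert hℓS, hL₀]; ring
    subst hL'
    -- `g` is the sieve of `g₀`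
    have hgs : g = sieveOp L₀ 2 ℓ g₀ := by
      refine eq_of_forall_cuspCoeff_eq_gamma0 fun n ↦ ?_
      rw [hg n]
      change _ = (UpperHalfPlane.qExpansion 1 ⇑(sieveOp L₀ 2 ℓ g₀)).coeff n
      rw [qExpansion_coeff_sieveOp hℓ g₀ n]
      change _ = (if ℓ ∣ n then 0 else cuspCoeff g₀ n)
      rw [hg₀ n]
      by_cases hℓn : ℓ ∣ n
      · rw [if_pos hℓn, if_pos ⟨ℓ, Finset.mem_insert_self ℓ S, hℓn⟩]
      · rw [if_neg hℓn]
        by_cases hex : ∃ ℓ' ∈ S, ℓ' ∣ n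
        · obtain ⟨ℓ', hℓ', hd⟩ := hex
          rw [if_pos ⟨ℓ', Finset.mem_insert_of_mem hℓ', hd⟩, if_pos ⟨ℓ', hℓ', hd⟩]
        · rw [if_neg hex, if_neg]
          rintro ⟨ℓ', hℓ', hd⟩
          rcases Finset.mem_insert.mp hℓ' with rfl | h
          · exact hℓn hd
          · exact hex ⟨ℓ', h, hd⟩
    -- `T_ℓ g₀ = a_ℓ(f) g₀` and `ℓ ∣ L₀ ↔ ℓ ∣ N`
    have hTg₀ : heckeT (Gamma0 L₀) 2 ℓ g₀ = cuspCoeff f ℓ • g₀ :=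
      depleted_heckeT_eq_smul hSp hg₀ hℓ hℓS (dvd_level_iff hSp rfl hℓ hℓS) (hT ℓ hℓ)
    have hℓN : ℓ ∣ L₀ ↔ ℓ ∣ N := dvd_level_iff hSp rfl hℓ hℓS
    -- the three modular symbols of `g₀` entering `{∞, r}_g`
    have hℓ0 : (ℓ : ℂ) ≠ 0 := by exact_mod_cast hℓ.ne_zero
    have huOp : ∀ s : ℚ, modularSymbol (uOp L₀ 2 ℓ g₀) s =
        cuspCoeff f ℓ * modularSymbol g₀ s - (if ℓ ∣ L₀ then (0 : ℂ) else (ℓ : ℂ)) * ((ℓ : ℂ)⁻¹ * modularSymbol g₀ (ℓ * s)) := by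
      intro s
      rw [uOp, LinearMap.sub_apply, LinearMap.comp_apply, LinearMap.smul_apply, modularSymbol_sub, modularSymbol_toLevel0, hTg₀,
        modularSymbol_const_smul, modularSymbol_const_smul, modularSymbol_iota]
      congr 2
      split_ifs <;> norm_num
    have hper : modularSymbol g r = modularSymbol g₀ r - (ℓ : ℂ)⁻¹ * modularSymbol (uOp L₀ 2 ℓ g₀) (ℓ * r) := by
      rw [hgs, sieveOp, LinearMap.sub_apply, LinearMap.comp_apply, modularSymbol_sub, modularSymbol_toLevel0, modularSymbol_iota]
    -- expand the product of depletion factors: `D_ℓ * ∏_S`, act multiplicatively, use the induction hypothesis at the dilated points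
    rw [Finset.prod_insert hℓS, act_mul]
    have hih : ∀ m₁ : ℕ, ((∏ ℓ' ∈ S, (MonoidAlgebra.single 1 (1 : ℂ) + MonoidAlgebra.single ℓ' (-(cuspCoeff f ℓ') * (ℓ' : ℂ)⁻¹) +
          MonoidAlgebra.single (ℓ' ^ 2) (if ℓ' ∣ N then 0 else (ℓ' : ℂ)⁻¹) : MonoidAlgebra ℂ ℕ)).coeff.sum
        fun m₂ a₂ ↦ a₂ * modularSymbol f ((m₂ : ℚ) * ((m₁ : ℚ) * r))) = modularSymbol g₀ ((m₁ : ℚ) * r) :=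
      fun m₁ ↦ (ih hSp L₀ rfl g₀ hg₀ ((m₁ : ℚ) * r)).symm
    simp_rw [hih]
    rw [act_depletionFactor, hper, huOp]
    by_cases hℓN' : ℓ ∣ N
    · rw [if_pos (hℓN.mpr hℓN'), if_pos hℓN']
      push_cast
      ring
    · rw [if_neg (fun h ↦ hℓN' (hℓN.mp h)), if_neg hℓN']
      push_cast
      field_simp
      ring

/-! ## §3 The period formula at any level `L` with `N·∏_{ℓ∈S} ℓ² ∣ L` -/

/-- **`{∞, r}_g = (∏_{ℓ∈S} D_ℓ)·{∞, ·}_f (r)` at ANY admissible level** (`N·∏_{ℓ∈S} ℓ² ∣ L`; the `S`-depleted form at level `L` is the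
level-raised one, `toLevel0` leaves `{∞, r}` unchanged). [cite: AtkinLehner1970, §3] [cite: EmertonPollackWeston2006, §3 (3.4)–(3.5)] -/
theorem modularSymbol_depleted_eq_act_of_dvd {N : ℕ} [NeZero N] (f : CuspForm (Gamma0 N) 2)
    (hT : ∀ (p : ℕ) (hp : p.Prime), (haveI : NeZero p := ⟨hp.ne_zero⟩; heckeT (Gamma0 N) 2 p f) = cuspCoeff f p • f)
    (S : Finset ℕ) (hS : ∀ ℓ ∈ S, ℓ.Prime) (L : ℕ) [NeZero L] (hNL : N * ∏ ℓ ∈ S, ℓ ^ 2 ∣ L)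
    (g : CuspForm (Gamma0 L) 2) (hg : ∀ n : ℕ, cuspCoeff g n = if ∃ ℓ ∈ S, ℓ ∣ n then 0 else cuspCoeff f n)
    (r : ℚ) :
    modularSymbol g r =
      ((∏ ℓ ∈ S, (MonoidAlgebra.single 1 (1 : ℂ) + MonoidAlgebra.single ℓ (-(cuspCoeff f ℓ) * (ℓ : ℂ)⁻¹) +
          MonoidAlgebra.single (ℓ ^ 2) (if ℓ ∣ N then 0 else (ℓ : ℂ)⁻¹) : MonoidAlgebra ℂ ℕ)).coeff.sum
        fun m a ↦ a * modularSymbol f ((m : ℚ) * r)) := by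
  classical
  set L₀ : ℕ := N * ∏ ℓ ∈ S, ℓ ^ 2 with hL₀
  haveI : NeZero L₀ := ⟨mul_ne_zero (NeZero.ne N) (prod_sq_ne_zero_of_prime S hS)⟩
  obtain ⟨g₀, hg₀⟩ := exists_cuspForm_coeff_eq_depleted f S hS L₀ rfl
  have hgs : g = toLevel0 hNL 2 g₀ := by
    refine eq_of_forall_cuspCoeff_eq_gamma0 fun n ↦ ?_
    rw [hg n]
    exact (hg₀ n).symm
  rw [hgs, modularSymbol_toLevel0]
  exact modularSymbol_depleted_eq_act f hT S hS L₀ rfl g₀ hg₀ r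

/-! ## §4 From `f`'s PLUS-SYMBOL TABLE: `re {∞, r}_g = Ω⁺_f · (eulerDepleteTableList W l [·]⁺_f)(r)` -/

section Tables

open Literature.NumberTheory.EllipticCurves.GreenbergVatsal2000 IsDedekindDomain NumberField

variable (W : WeierstrassCurve ℚ) [W.IsElliptic] [W.IsGloballyMinimal]

/-- **The coefficients of `L_v(W, X) ∈ ℤ[X]`**: `1, −a_ℓ(W), 𝟙_{ℓ∤N_W}·ℓ` in degrees `0, 1, 2` (read off bsd-wall's
`map_localPolynomialAt_eq` by injectivity of `ℤ → ℚ̄₂`), and degree `≤ 2`. [cite: SilvermanAEC2009, §C.16] -/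
theorem coeff_localPolynomialAt (v : HeightOneSpectrum (𝓞 ℚ)) :
    (W.localPolynomialAt v).coeff 0 = 1 ∧
      (W.localPolynomialAt v).coeff 1 = -(W.LFunction (Rat.HeightOneSpectrum.natGenerator v)) ∧
      (W.localPolynomialAt v).coeff 2 =
        (if Rat.HeightOneSpectrum.natGenerator v ∣ W.conductorNorm ℤ then 0 else (Rat.HeightOneSpectrum.natGenerator v : ℤ)) ∧
      (W.localPolynomialAt v).natDegree ≤ 2 := by
  have h := map_localPolynomialAt_eq W v
  have hinj : Function.Injective (Int.castRingHom (PadicAlgCl 2)) := Int.cast_injective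
  have hc : ∀ i : ℕ, ((W.localPolynomialAt v).coeff i : PadicAlgCl 2) =
      (1 - Polynomial.C ((W.LFunction (Rat.HeightOneSpectrum.natGenerator v) : PadicAlgCl 2)) * Polynomial.X +
        (if Rat.HeightOneSpectrum.natGenerator v ∣ W.conductorNorm ℤ then 0
          else Polynomial.C (Rat.HeightOneSpectrum.natGenerator v : PadicAlgCl 2)) * Polynomial.X ^ 2).coeff i := fun i ↦ by
    rw [← h, Polynomial.coeff_map, eq_intCast]
  refine ⟨?_, ?_, ?_, WeierstrassCurve.natDegree_localPolynomial_le_two _⟩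
  · apply hinj
    rw [eq_intCast, hc 0]
    split_ifs <;>
      simp only [Polynomial.coeff_add, Polynomial.coeff_sub, Polynomial.coeff_one, Polynomial.coeff_C_mul, Polynomial.coeff_X,
        Polynomial.coeff_X_pow, zero_mul, Polynomial.coeff_zero] <;> norm_num
  · apply hinj
    rw [eq_intCast, hc 1]
    split_ifs <;>
      simp only [Polynomial.coeff_add, Polynomial.coeff_sub, Polynomial.coeff_one, Polynomial.coeff_C_mul, Polynomial.coeff_X,
        Polynomial.coeff_X_pow, zero_mul, Polynomial.coeff_zero] <;> norm_num
  · apply hinj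
    rw [eq_intCast, hc 2]
    split_ifs <;>
      simp only [Polynomial.coeff_add, Polynomial.coeff_sub, Polynomial.coeff_one, Polynomial.coeff_C_mul, Polynomial.coeff_X,
        Polynomial.coeff_X_pow, zero_mul, Polynomial.coeff_zero] <;> norm_num

/-- **One depletion step on a table, three-term form**: `(P_v(ℓ⁻¹[ℓ])φ)(x) = φ(x) − (a_ℓ/ℓ)φ(ℓx) + 𝟙_{ℓ∤N_W} ℓ⁻¹ φ(ℓ²x)`.
[cite: EmertonPollackWeston2006, §3 (3.4)–(3.5)] -/
theorem eulerDepleteTable_eq_three (v : HeightOneSpectrum (𝓞 ℚ)) (φ : ℚ → ℚ) (x : ℚ) :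
    eulerDepleteTable W v φ x =
      φ x + (-(W.LFunction (Rat.HeightOneSpectrum.natGenerator v) : ℚ) * (Rat.HeightOneSpectrum.natGenerator v : ℚ)⁻¹) *
          φ ((Rat.HeightOneSpectrum.natGenerator v : ℚ) * x) +
        (if Rat.HeightOneSpectrum.natGenerator v ∣ W.conductorNorm ℤ then 0 else (Rat.HeightOneSpectrum.natGenerator v : ℚ)⁻¹) *
          φ (((Rat.HeightOneSpectrum.natGenerator v ^ 2 : ℕ) : ℚ) * x) := by
  obtain ⟨h0, h1, h2, hdeg⟩ := coeff_localPolynomialAt W v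
  set ℓ := Rat.HeightOneSpectrum.natGenerator v with hℓ
  have hℓ0 : (ℓ : ℚ) ≠ 0 := by exact_mod_cast (Rat.HeightOneSpectrum.prime_natGenerator v).ne_zero
  -- extend the sum to `range 3` (the extra coefficients vanish)
  have hsum : eulerDepleteTable W v φ x = ∑ i ∈ Finset.range 3, eulerDepletionWeight W v i * φ ((ℓ : ℚ) ^ i * x) := by
    unfold eulerDepleteTable
    refine Finset.sum_subset (Finset.range_mono (by omega)) fun i hi hni ↦ ?_
    have hlt : (W.localPolynomialAt v).natDegree < i := by
      simp only [Finset.mem_range, not_lt] at hi hni; omega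
    rw [eulerDepletionWeight, Polynomial.coeff_eq_zero_of_natDegree_lt hlt, Int.cast_zero, zero_mul, zero_mul]
  rw [hsum, Finset.sum_range_succ, Finset.sum_range_succ, Finset.sum_range_succ, Finset.sum_range_zero, zero_add]
  simp only [eulerDepletionWeight, h0, h1, h2, ← hℓ, pow_zero, pow_one, Int.cast_one, one_mul, mul_one, Int.cast_neg]
  congr 1
  push_cast
  split_ifs with hd
  · simp
  · rw [pow_two, ← mul_assoc, mul_inv_cancel₀ hℓ0, one_mul]

/-- **The `ℚ`-table depletion is the monoid-algebra action of `∏_{v∈l} D_{ℓ_v}`, read in `ℂ`** (`l` duplicate-free; `D_ℓ` as in §2 with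
`a_ℓ = W.LFunction ℓ`, `N = N_W`). Induction on `l`. [cite: GreenbergVatsal2000, §1 (8)] -/
theorem cast_eulerDepleteTableList_eq_act (l : List (HeightOneSpectrum (𝓞 ℚ))) (hl : l.Nodup) (φ : ℚ → ℚ) (c : ℂ)
    (ψ : ℚ → ℂ) (hψ : ∀ y : ℚ, ψ y = c * ((φ y : ℚ) : ℂ)) (x : ℚ) :
    c * ((eulerDepleteTableList W l φ x : ℚ) : ℂ) =
      ((∏ ℓ ∈ (l.map Rat.HeightOneSpectrum.natGenerator).toFinset,
          (MonoidAlgebra.single 1 (1 : ℂ) + MonoidAlgebra.single ℓ (-((W.LFunction ℓ : ℤ) : ℂ) * (ℓ : ℂ)⁻¹) +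
            MonoidAlgebra.single (ℓ ^ 2) (if ℓ ∣ W.conductorNorm ℤ then 0 else (ℓ : ℂ)⁻¹) : MonoidAlgebra ℂ ℕ)).coeff.sum
        fun m a ↦ a * ψ ((m : ℚ) * x)) := by
  classical
  induction l generalizing x with
  | nil =>
    rw [List.map_nil, List.toFinset_nil, Finset.prod_empty, MonoidAlgebra.one_def, act_single, Nat.cast_one, one_mul, one_mul, hψ]
    rfl
  | cons v l ih =>
    have hvl : v ∉ l := (List.nodup_cons.mp hl).1
    have hl' : l.Nodup := (List.nodup_cons.mp hl).2
    have hnot : Rat.HeightOneSpectrum.natGenerator v ∉ (l.map Rat.HeightOneSpectrum.natGenerator).toFinset := by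
      rw [List.mem_toFinset, List.mem_map]
      rintro ⟨w, hw, hwv⟩
      exact hvl ((Rat.HeightOneSpectrum.primesEquiv.injective (Subtype.ext hwv)) ▸ hw)
    rw [List.map_cons, List.toFinset_cons, Finset.prod_insert hnot, act_mul]
    simp_rw [← ih hl']
    rw [act_depletionFactor (fun y ↦ c * ((eulerDepleteTableList W l φ y : ℚ) : ℂ))]
    change c * ((eulerDepleteTable W v (eulerDepleteTableList W l φ) x : ℚ) : ℂ) = _
    rw [eulerDepleteTable_eq_three]
    split_ifs <;> push_cast <;> ring

variable {W}
variable [NeZero (W.conductorNorm ℤ)] {f : CuspForm (Gamma0 (W.conductorNorm ℤ)) 2}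

omit [W.IsElliptic] [W.IsGloballyMinimal] in
/-- `re {∞, y}_f = Ω⁺_f · [y]⁺_f` for the newform of `W` (`plusSymbol_eq_re_holds`, `ratCast_ratPlusSymbol_holds`, `Ω⁺_f > 0`).
[cite: MazurTateTeitelbaum1986Invent, §I.8] -/
theorem re_modularSymbol_eq_plusPeriod_mul (hf : IsNewformOf W f) (y : ℚ) :
    ((modularSymbol f y).re : ℂ) = (plusPeriod f : ℂ) * ((ratPlusSymbol f y : ℚ) : ℂ) := by
  have hQ := hf.coeffField_eq_bot
  have hreal : ∀ n, (cuspCoeff f n).im = 0 := fun n ↦ by rw [hf.2 n, Complex.intCast_im]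
  have hpos : 0 < plusPeriod f := IsNewform0.plusPeriod_pos_holds hf.1 hQ
  have h1 : (ratPlusSymbol f y : ℝ) = (plusSymbol f y).re / plusPeriod f := ratCast_ratPlusSymbol_holds hf.1 hQ y
  have h2 : plusSymbol f y = ((modularSymbol f y).re : ℂ) := plusSymbol_eq_re_holds f hreal y
  have h3 : (modularSymbol f y).re = plusPeriod f * (ratPlusSymbol f y : ℝ) := by
    rw [h1, h2, Complex.ofReal_re]; field_simp
  rw [h3]; push_cast; rfl

/-- **`re {∞, r}_g = Ω⁺_f · (∏_{v∈l} P_v(ℓ_v⁻¹[ℓ_v]) [·]⁺_f)(r)`**: for the newform `f` of `W` (globally minimal), a duplicate-free list `l` of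
places, `S = {ℓ_v}`, a level `L` with `N_W·∏_{ℓ∈S} ℓ² ∣ L` and the `S`-depleted form `g ∈ S₂(Γ₀(L))`, the real part of every modular symbol of
`g` is `Ω⁺_f` times the DEPLETED RATIONAL PLUS-SYMBOL TABLE `eulerDepleteTableList W l (ratPlusSymbol f)` of the line's `Σ`-statements.
[cite: EmertonPollackWeston2006, §3 (3.4)–(3.5)] [cite: GreenbergVatsal2000, §1 (8)] -/
theorem re_modularSymbol_depleted_eq (hf : IsNewformOf W f) (l : List (HeightOneSpectrum (𝓞 ℚ))) (hl : l.Nodup)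
    (L : ℕ) [NeZero L]
    (hNL : W.conductorNorm ℤ * ∏ ℓ ∈ (l.map Rat.HeightOneSpectrum.natGenerator).toFinset, ℓ ^ 2 ∣ L)
    (g : CuspForm (Gamma0 L) 2)
    (hg : ∀ n : ℕ, cuspCoeff g n =
      if ∃ ℓ ∈ (l.map Rat.HeightOneSpectrum.natGenerator).toFinset, ℓ ∣ n then 0 else cuspCoeff f n)
    (r : ℚ) :
    ((modularSymbol g r).re : ℂ) = (plusPeriod f : ℂ) * ((eulerDepleteTableList W l (ratPlusSymbol f) r : ℚ) : ℂ) := by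
  classical
  have hS : ∀ ℓ ∈ (l.map Rat.HeightOneSpectrum.natGenerator).toFinset, ℓ.Prime := by
    intro ℓ hℓ
    rw [List.mem_toFinset, List.mem_map] at hℓ
    obtain ⟨w, -, rfl⟩ := hℓ
    exact Rat.HeightOneSpectrum.prime_natGenerator w
  have hTf : ∀ (p : ℕ) (hp : p.Prime), (haveI : NeZero p := ⟨hp.ne_zero⟩; heckeT (Gamma0 (W.conductorNorm ℤ)) 2 p f) = cuspCoeff f p • f :=
    fun p hp ↦ by haveI : NeZero p := ⟨hp.ne_zero⟩; exact hf.1.heckeT_eq_coeff_smul hp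
  have hgreal : ∀ n, (cuspCoeff g n).im = 0 := fun n ↦ by
    rw [hg n]; split_ifs
    · simp
    · rw [hf.2 n, Complex.intCast_im]
  -- the plus symbols of `g` and of `f`
  have hpg : plusSymbol g r = ((modularSymbol g r).re : ℂ) := plusSymbol_eq_re_holds g hgreal r
  -- `{∞, ±r}_g` by the complex period formula
  have hact := modularSymbol_depleted_eq_act_of_dvd f hTf _ hS L hNL g (fun n ↦ by convert hg n using 2)
  have ha : ∀ ℓ : ℕ, cuspCoeff f ℓ = ((W.LFunction ℓ : ℤ) : ℂ) := fun ℓ ↦ hf.2 ℓ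
  rw [← hpg, plusSymbol, hact r, hact (-r)]
  simp_rw [ha]
  -- `x ↦ (m x)` commutes with negation; combine the two actions into the action on the plus symbol
  have hneg : ∀ m : ℕ, ((m : ℚ) * -r) = -((m : ℚ) * r) := fun m ↦ by ring
  simp_rw [hneg]
  have key := cast_eulerDepleteTableList_eq_act W l hl (ratPlusSymbol f) (plusPeriod f : ℂ)
    (fun y ↦ (plusPeriod f : ℂ) * ((ratPlusSymbol f y : ℚ) : ℂ)) (fun y ↦ rfl) r
  rw [key, ← Finsupp.sum_add, div_eq_mul_inv, Finsupp.sum_mul]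
  refine Finsupp.sum_congr fun m _ ↦ ?_
  have hfreal : ∀ n, (cuspCoeff f n).im = 0 := fun n ↦ by rw [hf.2 n, Complex.intCast_im]
  have hsym : modularSymbol f ((m : ℚ) * r) + modularSymbol f (-((m : ℚ) * r)) = 2 * plusSymbol f ((m : ℚ) * r) := by
    rw [plusSymbol]; ring
  rw [← mul_add, hsym, plusSymbol_eq_re_holds f hfreal, re_modularSymbol_eq_plusPeriod_mul hf]
  ring

end Tables

end Summit.BirchSwinnertonDyer.BirchSwinnertonDyer.Theorems.AlignedTransportAtTwoDepletedPeriodFormula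

end
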